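import Summits.RiemannHypothesis.RiemannHypothesis.Theorems.ThetaTier1ChebBridgeMain
import Summits.RiemannHypothesis.RiemannHypothesis.Theorems.WeilColumnThetaUCCheb
import HarnessLib

/-!
# THETA tier-1: FIN — a kernel-certified row gives the upper clause `a*(S_q) < (log q⁺)/2`, and the wall sentence (RH-FREE)

Cell `rh-explicit`, WEIL column, seat weil-1 gen20 (director-rh g5 2026-08-26T09:40Z rulings; THETA-ASSIGN §2 (AR) ∘ (AN)). The glue of
the two landed halves of the tier-1 theta certificate, in the RS-FREE (Chebyshev) form:

* (AR) cc-s2-1 `ThetaTier1.lossCheb_lt_gain_of_realCertCheb_four`: a row `r` with `r.RealCertCheb` (what `checkAllCheb rows = true` yields through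
  `checkAllCheb_sound`) gives `(ofRow r).Admissible r.qn ∧ e² ≤ chebN ∧ lossCheb (2^{-k}) < gain 16` over cc-s2-3's `ThetaParams`;
* (AN) weil-1 `ThetaParams.ucCheb_of_lossCheb_lt_gain`: that, with `ConsecutivePrimes q qn`, gives `weilSemilocalThreshold (primesBelow q) < log qn / 2`.

Hence `uc_of_realCertCheb` (per row), `uc_of_rows` (per certified list) and **`walls_of_rows`**: for a certified list `rows`, every `q` in its
prime column satisfies the WALL SENTENCE of the route items — `∀ q' prime, q < q' → a*(S_q) < (log q')/2` (`q⁺ ≤ q'` from `ConsecutivePrimes`).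
The item closers (`WallsTenKNonTwin`, `WallsSixtyKNonTwin`) are `walls_of_rows` on the data modules plus the cover theorems. Finite certificates,
RH-FREE bookkeeping; nothing here bears on the truth of RH.
-/

set_option linter.dupNamespace false  -- the mandated namespace repeats `RiemannHypothesis`

noncomputable section

namespace Summit.RiemannHypothesis.RiemannHypothesis.Theorems.ThetaTier1

open Summit.RiemannHypothesis.RiemannHypothesis.Theorems.WeilColumn.ThetaMellin
open Literature.NumberTheory.LFunctions

/-- **FIN, per row**: a tier-1 row with `m = 4`, `2 ≤ q`, kernel certificate `r.RealCertCheb` and `q < q⁺` consecutive primes has the upper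
clause `a*(S_q) < (log q⁺)/2`. [THETA-ASSIGN §2 (AR) ∘ (AN); RH-FREE] -/
theorem uc_of_realCertCheb (r : Row) (hm : r.m = 4) (hq : 2 ≤ r.q) (hc : r.RealCertCheb)
    (hcons : Handoff.ConsecutivePrimes r.q r.qn) :
    MotivicDoor.SemilocalThreshold.weilSemilocalThreshold (Nat.primesBelow r.q) < Real.log r.qn / 2 := by
  obtain ⟨hP, hN, hlg⟩ := lossCheb_lt_gain_of_realCertCheb_four r hm hq hc
  -- unfold cc-s2-1's four Chebyshev definitions to the spelled-out form of `ucCheb_of_lossCheb_lt_gain` (no unfolding of `ofRow r`)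
  simp only [ThetaParams.lossCheb, ThetaParams.crossCheb, ThetaParams.chebConst, ThetaParams.chebN] at hlg hN
  have ht₀ : (0 : ℝ) < 1 / 2 ^ r.k := by positivity
  have ht₁ : (1 : ℝ) / 2 ^ r.k ≤ 1 := by
    rw [one_div]; exact inv_le_one_of_one_le₀ (one_le_pow₀ (by norm_num))
  have hJ : 0 < JSTEPS := by decide
  have hcons' : Handoff.ConsecutivePrimes (ofRow r).q r.qn := by rwa [ofRow_q]
  have h := ThetaParams.ucCheb_of_lossCheb_lt_gain (P := ofRow r) hP hcons' hN ht₀ ht₁ hJ hlg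
  rwa [ofRow_q] at h

/-- **FIN, per certified list**: every row of a list with `RealCertCheb` and the row facts has the upper clause. [THETA-ASSIGN §2; RH-FREE] -/
theorem uc_of_rows {rows : List Row} (hc : ∀ r ∈ rows, r.RealCertCheb)
    (hf : ∀ r ∈ rows, r.m = 4 ∧ 2 ≤ r.q ∧ Handoff.ConsecutivePrimes r.q r.qn) :
    ∀ r ∈ rows, Handoff.ConsecutivePrimes r.q r.qn ∧
      MotivicDoor.SemilocalThreshold.weilSemilocalThreshold (Nat.primesBelow r.q) < Real.log r.qn / 2 := fun r hr ↦
  ⟨(hf r hr).2.2, uc_of_realCertCheb r (hf r hr).1 (hf r hr).2.1 (hc r hr) (hf r hr).2.2⟩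

/-- From the upper clause at consecutive primes to the wall sentence: `a*(S_q) < (log q⁺)/2` and `q⁺ ≤ q'` for every prime `q' > q`.
[folklore] -/
theorem wall_of_uc {q qn : ℕ} (hcons : Handoff.ConsecutivePrimes q qn)
    (huc : MotivicDoor.SemilocalThreshold.weilSemilocalThreshold (Nat.primesBelow q) < Real.log qn / 2)
    (q' : ℕ) (hq' : q'.Prime) (hlt : q < q') :
    MotivicDoor.SemilocalThreshold.weilSemilocalThreshold (Nat.primesBelow q) < Real.log q' / 2 := by
  have hle : qn ≤ q' := hcons.2.2.2 q' hq' hlt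
  have hqn : 0 < (qn : ℝ) := by exact_mod_cast hcons.2.1.pos
  have hlog : Real.log qn ≤ Real.log q' := Real.log_le_log hqn (by exact_mod_cast hle)
  linarith

/-- **FIN — THE WALL SENTENCE FOR A CERTIFIED LIST**: if every row of `rows` is kernel-certified (`RealCertCheb`) with the row facts
(`m = 4`, `2 ≤ q`, `q < q⁺` consecutive primes), then every `q` in the prime column of `rows` satisfies the route items' sentence
`∀ q' prime, q < q' → a*(S_q) < (log q')/2`. [THETA-ASSIGN §2 (AR) ∘ (AN); RH-FREE] -/
theorem walls_of_rows {rows : List Row} (hc : ∀ r ∈ rows, r.RealCertCheb)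
    (hf : ∀ r ∈ rows, r.m = 4 ∧ 2 ≤ r.q ∧ Handoff.ConsecutivePrimes r.q r.qn) :
    ∀ q ∈ rows.map Row.q, ∀ q' : ℕ, q'.Prime → q < q' →
      MotivicDoor.SemilocalThreshold.weilSemilocalThreshold (Nat.primesBelow q) < Real.log q' / 2 := by
  intro q hq q' hq' hlt
  obtain ⟨r, hr, rfl⟩ := List.mem_map.1 hq
  obtain ⟨hcons, huc⟩ := uc_of_rows hc hf r hr
  exact wall_of_uc hcons huc q' hq' hlt

/-- The wall sentence is stable under list append (bookkeeping for the item closers). [folklore] -/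
theorem walls_append {l₁ l₂ : List ℕ}
    (h₁ : ∀ q ∈ l₁, ∀ q' : ℕ, q'.Prime → q < q' →
      MotivicDoor.SemilocalThreshold.weilSemilocalThreshold (Nat.primesBelow q) < Real.log q' / 2)
    (h₂ : ∀ q ∈ l₂, ∀ q' : ℕ, q'.Prime → q < q' →
      MotivicDoor.SemilocalThreshold.weilSemilocalThreshold (Nat.primesBelow q) < Real.log q' / 2) :
    ∀ q ∈ l₁ ++ l₂, ∀ q' : ℕ, q'.Prime → q < q' →
      MotivicDoor.SemilocalThreshold.weilSemilocalThreshold (Nat.primesBelow q) < Real.log q' / 2 := by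
  intro q hq
  rcases List.mem_append.1 hq with h | h
  · exact h₁ q h
  · exact h₂ q h

end Summit.RiemannHypothesis.RiemannHypothesis.Theorems.ThetaTier1

end
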